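import Summits.MatrixMultiplication.MatrixMultiplication.Theorems.ObstructionDescentUniversalOccurrenceThree
import Summits.MatrixMultiplication.MatrixMultiplication.Theorems.ObstructionDescentUniversalOccurrenceFive

set_option linter.dupNamespace false
set_option autoImplicit false

/-!
# Universal occurrence, row `N = 5` sharpened: `¬UOCC(7, 5)`, hence `8 ≤ u(N)` for every `N ≥ 5` (route `ObstructionDescent`)

Support file (kernel K15) for the crux `NoOccurrenceObstruction` (`P_O`, item `stmt-MatrixMultiplication-29040`) of
`Summit.MatrixMultiplication.MatrixMultiplication.Theses.ObstructionDescent`; sequel of `ObstructionDescentUniversalOccurrenceThree` (K14: `u(3) = 5` by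
Strassen's degree-`12` obstruction of multiplicity one, and the general bound `dim HWV_Λ ≤ g(λ)`) and of `ObstructionDescentUniversalOccurrenceFive` (K11: the
window `7 ≤ u(5) ≤ 10`).  `UOCC(m, N)` (spelled out literally below): every partition triple occurring in a tensor power of some complex tensor on `≤ N` letters
occurs in the same power of the unit tensor `⟨m⟩`; `u(N)` is the least such `m`.  The lower cell of row `5` moves from `7` to `8` by a second OBSTRUCTION OF
MULTIPLICITY ONE, this time a KOSZUL FLATTENING (Landsberg–Ottaviani) instead of Strassen's commutator:
* the type `λ_K = ((5,5,5),(3,3,3,3,3),(3,3,3,3,3)) ⊢ 15` has `g(λ_K) = 1` (`kroneckerCoeff_koszulType`: class sum `= 15!` by the verified Murnaghan–Nakayama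
  evaluator, `decide +kernel`), so `dim HWV_{Λ_K}(ℂ[ℂ⁷⊗ℂ⁷⊗ℂ⁷]₁₅) ≤ 1` (`finrank_hwvSpace_le_kroneckerCoeff`, K14);
* the Koszul–Strassen form `F = det K(Y₀,Y₁,Y₂)`, `K(Y) = [[0, Y₂, −Y₁], [−Y₂, 0, Y₀], [Y₁, −Y₀, 0]] = Σ_k E_k ⊗ Y_k` (`(E_k)_{ij} = ε_{ijk}`; the `p = 1`
  Koszul flattening `A ⊗ B* → Λ²A ⊗ C` of a `3 × 5 × 5` tensor, a `15 × 15` matrix of linear forms), read in the block variables `x_{(4+k)(2+b)(2+c)}` of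
  `ℂ⁷⊗ℂ⁷⊗ℂ⁷` (top three `A`-letters, top five `B`- and `C`-letters), is a highest weight vector of reversed type `λ_K` (`koszulForm_mem_hwvSpace`), by two laws
  valid over any commutative ring: the SANDWICH law `K(BY₀Cᵀ,BY₁Cᵀ,BY₂Cᵀ) = (1⊗B)·K(Y)·(1⊗Cᵀ)` and the SLICE-MIXING law `(aᵀ⊗1)·K(a·Y)·(a⊗1) = det a · K(Y)`
  (the cross product is `SL₃`-equivariant), whence `det K((a,B,C)·Y) = det a⁵ det B³ det C³ · det K(Y)`;
* `F` vanishes on `Mat₇³·⟨7⟩` (`evalT_fromCols_koszulForm`): the block of `[A|B|C]` has rank `≤ 7` and `K(α⊗u⊗v) = E(α) ⊗ uvᵀ` has rank `≤ 2` (`E(α) = [·×α]`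
  is singular), so `rk K ≤ 2·7 = 14 < 15` (`koszulMatrix_det_eq_zero_of_tensorRank_le`, the coordinate form of Landsberg–Ottaviani's rank bound; no density
  argument is needed); hence `HWV_{Λ_K} = ℂ·F ⊆ I(GL₇³·⟨7⟩)`: `λ_K` does not occur in `⟨7⟩^{⊗15}` (`isotypicSum_koszulType_unitTensor_seven_eq_zero`);
* `F ≠ 0` at the padding of the `5×5×5` tensor `s₀ = (0 | 0 | diag(0,1,2,3,4) | P_cyc | 1)` (`det K(diag, P_cyc, 1) = −4`; certified in the kernel as
  `rank = 15` by a `39`-pair sparse integer row certificate, `le_rank_of_intTriCheck`), so `λ_K` occurs in `s₀^{⊗15}` (padding bridge).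
Hence `¬UOCC(7, 5)` (`not_uocc_seven_five`), `UOCC(m, N) → 8 ≤ m` for all `N ≥ 5` (`eight_le_of_uocc`), and the row-`5` window `8 ≤ u(5) ≤ 10`
(`uocc_five_window'`).  Ladder now: `u(2) ≤ 2`, `u(3) = 5`, `6 ≤ u(4) ≤ 7`, `8 ≤ u(5) ≤ 10`, `8 ≤ u(6) ≤ 14`, `10 ≤ u(7) ≤ 19`,
`max(8, 3⌊(N−1)/2⌋ + 1) ≤ u(N) ≤ ⌈N²/2⌉` (`8 ≤ N ≤ 16`).  All theorems, no `def`, no `sorry`, standard axioms (`decide +kernel` only for the class sum and the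
integer certificate).  (For `N = 4, 6, 7` the analogous Koszul types `((N,N,N),(3^N),(3^N))` have `g = 2, 3, 2`, so one form does not decide them.)
References: J. M. Landsberg, G. Ottaviani, Theory of Computing 11 (2015) / arXiv:1112.6007, Thm. 2.1 [key LandsbergOttaviani2015]; J. M. Landsberg,
*Geometry and complexity theory*, CUP 2017, Prop. 2.4.2.1, §2.1.6 [key LandsbergGCT2017]; V. Strassen, Linear Algebra Appl. 52/53 (1983) [key Strassen1983];
Bürgisser–Ikenmeyer, STOC 2011 / arXiv:1011.1350, §3.1, Lemma 3.2, §10.1 [key BurgisserIkenmeyer2011]; Fulton–Harris, GTM 129, Ex. 4.51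
[key FultonHarrisGTM129]; T. Lickteig, Linear Algebra Appl. 69 (1985) [key Lickteig1985].
-/

open scoped BigOperators Kronecker
namespace Summit.MatrixMultiplication.MatrixMultiplication.Theorems.ObstructionCalculus

open MvPolynomial Matrix
open Literature.Computability.AlgebraicComplexity (actTensor actTensor_apply kroneckerPow isotypicSum₁ isotypicSum₂ isotypicSum₃ unitTensor
  tensorRank triad triad_apply tensorRank_le_of_eq_sum exists_triad_decomposition_tensorRank matrix_rank_sum_le)
open Literature.NumberTheory.DiophantineGeometry (kroneckerCoeff)
open Literature.RepresentationTheory.FiniteGroups.MNEval (kronSum kroneckerCoeff_eq_kronSum_div)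
open Literature.LinearAlgebra.Matrix (intTriCheck le_rank_of_intTriCheck)

/-! ## §0  The Koszul–Strassen matrix `K(Y₀,Y₁,Y₂) = [[0, Y₂, −Y₁], [−Y₂, 0, Y₀], [Y₁, −Y₀, 0]]` over a commutative ring: four laws -/

/-- `K(Y) = E₀ ⊗ Y₀ + E₁ ⊗ Y₁ + E₂ ⊗ Y₂` with `(E_k)_{ij} = ε_{ijk}` (Kronecker form of the block matrix). [bookkeeping] -/
theorem koszulMatrix_eq_kronecker {R : Type*} [CommRing R] {n : ℕ} (Y : Fin 3 → Matrix (Fin n) (Fin n) R) :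
    (Matrix.of fun p q : Fin 3 × Fin n => !![(0 : R), Y 2 p.2 q.2, -Y 1 p.2 q.2; -Y 2 p.2 q.2, 0, Y 0 p.2 q.2; Y 1 p.2 q.2, -Y 0 p.2 q.2, 0] p.1 q.1) =
      !![(0 : R), 0, 0; 0, 0, 1; 0, -1, 0] ⊗ₖ Y 0 + !![(0 : R), 0, -1; 0, 0, 0; 1, 0, 0] ⊗ₖ Y 1 + !![(0 : R), 1, 0; -1, 0, 0; 0, 0, 0] ⊗ₖ Y 2 := by
  ext ⟨i, b⟩ ⟨j, c⟩
  fin_cases i <;> fin_cases j <;> simp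

/-- **Sandwich law**: `K(B Y₀ Cᵀ, B Y₁ Cᵀ, B Y₂ Cᵀ) = (1 ⊗ B) · K(Y) · (1 ⊗ Cᵀ)`. [folklore] -/
theorem koszulMatrix_sandwich {R : Type*} [CommRing R] {n : ℕ} (B C : Matrix (Fin n) (Fin n) R) (Y : Fin 3 → Matrix (Fin n) (Fin n) R) :
    (Matrix.of fun p q : Fin 3 × Fin n => !![(0 : R), (B * Y 2 * Cᵀ) p.2 q.2, -(B * Y 1 * Cᵀ) p.2 q.2; -(B * Y 2 * Cᵀ) p.2 q.2, 0, (B * Y 0 * Cᵀ) p.2 q.2;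
        (B * Y 1 * Cᵀ) p.2 q.2, -(B * Y 0 * Cᵀ) p.2 q.2, 0] p.1 q.1) =
      ((1 : Matrix (Fin 3) (Fin 3) R) ⊗ₖ B) * (Matrix.of fun p q : Fin 3 × Fin n => !![(0 : R), Y 2 p.2 q.2, -Y 1 p.2 q.2; -Y 2 p.2 q.2, 0, Y 0 p.2 q.2;
        Y 1 p.2 q.2, -Y 0 p.2 q.2, 0] p.1 q.1) * ((1 : Matrix (Fin 3) (Fin 3) R) ⊗ₖ Cᵀ) := by
  rw [koszulMatrix_eq_kronecker (fun k => B * Y k * Cᵀ), koszulMatrix_eq_kronecker Y]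
  simp only [Matrix.mul_add, Matrix.add_mul, ← Matrix.mul_kronecker_mul, Matrix.one_mul, Matrix.mul_one]

/-- **Slice-mixing law**: `(aᵀ ⊗ 1) · K(a·Y) · (a ⊗ 1) = det a · K(Y)` for `(a·Y)_k = Σ_l a_{kl} Y_l` — the cross product is `SL₃`-equivariant:
`Σ_{i'j'k} ε_{i'j'k} a_{i'i} a_{j'j} a_{kl} = det a · ε_{ijl}`. [folklore] -/
theorem koszulMatrix_mix {R : Type*} [CommRing R] {n : ℕ} (a : Matrix (Fin 3) (Fin 3) R) (Y : Fin 3 → Matrix (Fin n) (Fin n) R) :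
    (aᵀ ⊗ₖ (1 : Matrix (Fin n) (Fin n) R)) * (Matrix.of fun p q : Fin 3 × Fin n => !![(0 : R), (∑ l, a 2 l • Y l) p.2 q.2, -(∑ l, a 1 l • Y l) p.2 q.2;
        -(∑ l, a 2 l • Y l) p.2 q.2, 0, (∑ l, a 0 l • Y l) p.2 q.2; (∑ l, a 1 l • Y l) p.2 q.2, -(∑ l, a 0 l • Y l) p.2 q.2, 0] p.1 q.1) * (a ⊗ₖ (1 : Matrix (Fin n) (Fin n) R)) =
      a.det • (Matrix.of fun p q : Fin 3 × Fin n => !![(0 : R), Y 2 p.2 q.2, -Y 1 p.2 q.2; -Y 2 p.2 q.2, 0, Y 0 p.2 q.2; Y 1 p.2 q.2, -Y 0 p.2 q.2, 0] p.1 q.1) := by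
  have h0 : a.det • (!![(0 : R), 0, 0; 0, 0, 1; 0, -1, 0] : Matrix (Fin 3) (Fin 3) R) = a 0 0 • (aᵀ * !![(0 : R), 0, 0; 0, 0, 1; 0, -1, 0] * a) +
      a 1 0 • (aᵀ * !![(0 : R), 0, -1; 0, 0, 0; 1, 0, 0] * a) + a 2 0 • (aᵀ * !![(0 : R), 1, 0; -1, 0, 0; 0, 0, 0] * a) := by
    ext i j; fin_cases i <;> fin_cases j <;> simp [Matrix.mul_apply, Fin.sum_univ_three, Matrix.det_fin_three] <;> ring
  have h1 : a.det • (!![(0 : R), 0, -1; 0, 0, 0; 1, 0, 0] : Matrix (Fin 3) (Fin 3) R) = a 0 1 • (aᵀ * !![(0 : R), 0, 0; 0, 0, 1; 0, -1, 0] * a) +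
      a 1 1 • (aᵀ * !![(0 : R), 0, -1; 0, 0, 0; 1, 0, 0] * a) + a 2 1 • (aᵀ * !![(0 : R), 1, 0; -1, 0, 0; 0, 0, 0] * a) := by
    ext i j; fin_cases i <;> fin_cases j <;> simp [Matrix.mul_apply, Fin.sum_univ_three, Matrix.det_fin_three] <;> ring
  have h2 : a.det • (!![(0 : R), 1, 0; -1, 0, 0; 0, 0, 0] : Matrix (Fin 3) (Fin 3) R) = a 0 2 • (aᵀ * !![(0 : R), 0, 0; 0, 0, 1; 0, -1, 0] * a) +
      a 1 2 • (aᵀ * !![(0 : R), 0, -1; 0, 0, 0; 1, 0, 0] * a) + a 2 2 • (aᵀ * !![(0 : R), 1, 0; -1, 0, 0; 0, 0, 0] * a) := by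
    ext i j; fin_cases i <;> fin_cases j <;> simp [Matrix.mul_apply, Fin.sum_univ_three, Matrix.det_fin_three] <;> ring
  rw [koszulMatrix_eq_kronecker (fun k => ∑ l, a k l • Y l), koszulMatrix_eq_kronecker Y, smul_add, smul_add, ← Matrix.smul_kronecker, ← Matrix.smul_kronecker,
    ← Matrix.smul_kronecker, h0, h1, h2]
  simp only [Fin.sum_univ_three, Matrix.kronecker_add, Matrix.kronecker_smul, Matrix.add_kronecker, Matrix.smul_kronecker, Matrix.mul_add, Matrix.add_mul, Matrix.mul_smul,
    Matrix.smul_mul, ← Matrix.mul_kronecker_mul, Matrix.one_mul, Matrix.mul_one, Matrix.mul_assoc]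
  abel

/-- Determinant form of the sandwich law: `det K(B Y Cᵀ) = det B³ det C³ · det K(Y)`. [folklore] -/
theorem koszulMatrix_det_sandwich {R : Type*} [CommRing R] {n : ℕ} (B C : Matrix (Fin n) (Fin n) R) (Y : Fin 3 → Matrix (Fin n) (Fin n) R) :
    (Matrix.of fun p q : Fin 3 × Fin n => !![(0 : R), (B * Y 2 * Cᵀ) p.2 q.2, -(B * Y 1 * Cᵀ) p.2 q.2; -(B * Y 2 * Cᵀ) p.2 q.2, 0, (B * Y 0 * Cᵀ) p.2 q.2;
        (B * Y 1 * Cᵀ) p.2 q.2, -(B * Y 0 * Cᵀ) p.2 q.2, 0] p.1 q.1).det =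
      B.det ^ 3 * C.det ^ 3 * (Matrix.of fun p q : Fin 3 × Fin n => !![(0 : R), Y 2 p.2 q.2, -Y 1 p.2 q.2; -Y 2 p.2 q.2, 0, Y 0 p.2 q.2;
        Y 1 p.2 q.2, -Y 0 p.2 q.2, 0] p.1 q.1).det := by
  rw [koszulMatrix_sandwich, Matrix.det_mul, Matrix.det_mul, Matrix.det_kronecker, Matrix.det_kronecker, Matrix.det_one, Matrix.det_transpose, one_pow, one_mul, one_mul,
    Fintype.card_fin]
  ring

/-- Determinant form of the slice-mixing law over a field: `det K(a·Y) = det a ^ n · det K(Y)` when `det a ≠ 0`. [folklore] -/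
theorem koszulMatrix_det_mix {𝕜 : Type*} [Field 𝕜] {n : ℕ} (a : Matrix (Fin 3) (Fin 3) 𝕜) (ha : a.det ≠ 0) (Y : Fin 3 → Matrix (Fin n) (Fin n) 𝕜) :
    (Matrix.of fun p q : Fin 3 × Fin n => !![(0 : 𝕜), (∑ l, a 2 l • Y l) p.2 q.2, -(∑ l, a 1 l • Y l) p.2 q.2; -(∑ l, a 2 l • Y l) p.2 q.2, 0, (∑ l, a 0 l • Y l) p.2 q.2;
        (∑ l, a 1 l • Y l) p.2 q.2, -(∑ l, a 0 l • Y l) p.2 q.2, 0] p.1 q.1).det =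
      a.det ^ n * (Matrix.of fun p q : Fin 3 × Fin n => !![(0 : 𝕜), Y 2 p.2 q.2, -Y 1 p.2 q.2; -Y 2 p.2 q.2, 0, Y 0 p.2 q.2; Y 1 p.2 q.2, -Y 0 p.2 q.2, 0] p.1 q.1).det := by
  have h := congrArg Matrix.det (koszulMatrix_mix a Y)
  simp only [Matrix.det_mul, Matrix.det_kronecker, Matrix.det_smul, Matrix.det_transpose, Matrix.det_one, one_pow, mul_one, Fintype.card_prod, Fintype.card_fin] at h
  refine mul_left_cancel₀ (mul_ne_zero (pow_ne_zero n ha) (pow_ne_zero n ha)) ?_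
  calc a.det ^ n * a.det ^ n * _ = a.det ^ n * _ * a.det ^ n := by ring
    _ = a.det ^ (3 * n) * _ := h
    _ = _ := by ring

/-- **Vanishing law** (Koszul flattening of rank-`≤ r` tensors, `p = 1`, `dim A' = 3`): if the `3`-slice tensor `Z` has rank `≤ r` with `2r < 3n`, then
`det K(Z₀,Z₁,Z₂) = 0` — `K(α⊗u⊗v) = E(α) ⊗ u vᵀ` has rank `≤ rk E(α) ≤ 2` (`E(α) = (x ↦ x × α)` is a singular `3 × 3` matrix), so `rk K(Z) ≤ 2r < 3n`.  This is the
explicit-coordinate case `p = 1` of `Literature.Computability.AlgebraicComplexity.LandsbergOttaviani2015_rank_koszulFlattening_le`. [cite: LandsbergOttaviani2015, Thm. 2.1]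
[cite: LandsbergGCT2017, Prop. 2.4.2.1] -/
theorem koszulMatrix_det_eq_zero_of_tensorRank_le {𝕜 : Type*} [Field 𝕜] {n r : ℕ} (hr : 2 * r < 3 * n) (Z : Fin 3 → Fin n → Fin n → 𝕜) (hZ : tensorRank Z ≤ r) :
    (Matrix.of fun p q : Fin 3 × Fin n => !![(0 : 𝕜), Z 2 p.2 q.2, -Z 1 p.2 q.2; -Z 2 p.2 q.2, 0, Z 0 p.2 q.2; Z 1 p.2 q.2, -Z 0 p.2 q.2, 0] p.1 q.1).det = 0 := by
  classical
  obtain ⟨w, u, v, hZ'⟩ := exists_triad_decomposition_tensorRank Z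
  have hz : ∀ k b c, Z k b c = ∑ l, w l k * u l b * v l c := fun k b c => by
    conv_lhs => rw [hZ']
    simp [Finset.sum_apply, triad_apply]
  -- entry formula of the rank-`≤ 2` summands `P_l · E(w_l) · Q_l`
  have hPEQ : ∀ (u' v' : Fin n → 𝕜) (E : Matrix (Fin 3) (Fin 3) 𝕜) (i j : Fin 3) (b c : Fin n),
      ((Matrix.of fun (p : Fin 3 × Fin n) (k : Fin 3) => if p.1 = k then u' p.2 else 0) * E *
        (Matrix.of fun (k : Fin 3) (q : Fin 3 × Fin n) => if k = q.1 then v' q.2 else 0)) (i, b) (j, c) = u' b * E i j * v' c := by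
    intro u' v' E i j b c
    simp [Matrix.mul_apply, ite_mul, mul_ite, Finset.sum_ite_eq, Finset.sum_ite_eq']
  have hK : (Matrix.of fun p q : Fin 3 × Fin n => !![(0 : 𝕜), Z 2 p.2 q.2, -Z 1 p.2 q.2; -Z 2 p.2 q.2, 0, Z 0 p.2 q.2; Z 1 p.2 q.2, -Z 0 p.2 q.2, 0] p.1 q.1) =
      ∑ l : Fin (tensorRank Z), (Matrix.of fun (p : Fin 3 × Fin n) (k : Fin 3) => if p.1 = k then u l p.2 else 0) *
        !![(0 : 𝕜), w l 2, -w l 1; -w l 2, 0, w l 0; w l 1, -w l 0, 0] * (Matrix.of fun (k : Fin 3) (q : Fin 3 × Fin n) => if k = q.1 then v l q.2 else 0) := by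
    ext ⟨i, b⟩ ⟨j, c⟩
    rw [Matrix.sum_apply]; simp only [hPEQ, Matrix.of_apply]
    fin_cases i <;> fin_cases j <;> simp [hz, Finset.sum_neg_distrib, mul_comm, mul_left_comm]
  have hE : ∀ β : Fin 3 → 𝕜, (!![(0 : 𝕜), β 2, -β 1; -β 2, 0, β 0; β 1, -β 0, 0] : Matrix (Fin 3) (Fin 3) 𝕜).rank ≤ 2 := fun β => by
    have hdet : (!![(0 : 𝕜), β 2, -β 1; -β 2, 0, β 0; β 1, -β 0, 0] : Matrix (Fin 3) (Fin 3) 𝕜).det = 0 := by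
      simp [Matrix.det_fin_three]; ring
    have h3 := Matrix.rank_le_width (!![(0 : 𝕜), β 2, -β 1; -β 2, 0, β 0; β 1, -β 0, 0] : Matrix (Fin 3) (Fin 3) 𝕜)
    have hne : (!![(0 : 𝕜), β 2, -β 1; -β 2, 0, β 0; β 1, -β 0, 0] : Matrix (Fin 3) (Fin 3) 𝕜).rank ≠ 3 := fun h =>
      det_ne_zero_of_rank_eq_fintype_card _ (by rw [h, Fintype.card_fin]) hdet
    omega
  have hrank : (Matrix.of fun p q : Fin 3 × Fin n => !![(0 : 𝕜), Z 2 p.2 q.2, -Z 1 p.2 q.2; -Z 2 p.2 q.2, 0, Z 0 p.2 q.2; Z 1 p.2 q.2, -Z 0 p.2 q.2, 0] p.1 q.1).rank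
      ≤ 2 * r := by
    rw [hK]; refine (matrix_rank_sum_le _ _).trans ?_
    calc ∑ l : Fin (tensorRank Z), ((Matrix.of fun (p : Fin 3 × Fin n) (k : Fin 3) => if p.1 = k then u l p.2 else 0) *
            !![(0 : 𝕜), w l 2, -w l 1; -w l 2, 0, w l 0; w l 1, -w l 0, 0] * (Matrix.of fun (k : Fin 3) (q : Fin 3 × Fin n) => if k = q.1 then v l q.2 else 0)).rank
        ≤ ∑ _l : Fin (tensorRank Z), 2 := Finset.sum_le_sum fun l _ => (Matrix.rank_mul_le_left _ _).trans ((Matrix.rank_mul_le_right _ _).trans (hE _))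
      _ = 2 * tensorRank Z := by simp [mul_comm]
      _ ≤ 2 * r := by omega
  by_contra hdet
  have hU := Matrix.rank_of_isUnit _ ((Matrix.isUnit_iff_isUnit_det _).2 (isUnit_iff_ne_zero.2 hdet))
  rw [Fintype.card_prod, Fintype.card_fin, Fintype.card_fin] at hU
  omega

/-- Combined action law over a field: `det K(Σ_l a_{kl} · B Z_l Cᵀ) = det a ^ n · det B³ · det C³ · det K(Z)` (`det a ≠ 0`). [folklore] -/
theorem koszulMatrix_det_act {𝕜 : Type*} [Field 𝕜] {n : ℕ} (a : Matrix (Fin 3) (Fin 3) 𝕜) (ha : a.det ≠ 0) (B C : Matrix (Fin n) (Fin n) 𝕜)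
    (Z : Fin 3 → Matrix (Fin n) (Fin n) 𝕜) :
    (Matrix.of fun p q : Fin 3 × Fin n => !![(0 : 𝕜), (∑ l, a 2 l • (B * Z l * Cᵀ)) p.2 q.2, -(∑ l, a 1 l • (B * Z l * Cᵀ)) p.2 q.2;
        -(∑ l, a 2 l • (B * Z l * Cᵀ)) p.2 q.2, 0, (∑ l, a 0 l • (B * Z l * Cᵀ)) p.2 q.2; (∑ l, a 1 l • (B * Z l * Cᵀ)) p.2 q.2, -(∑ l, a 0 l • (B * Z l * Cᵀ)) p.2 q.2, 0] p.1 q.1).det =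
      a.det ^ n * B.det ^ 3 * C.det ^ 3 *
        (Matrix.of fun p q : Fin 3 × Fin n => !![(0 : 𝕜), Z 2 p.2 q.2, -Z 1 p.2 q.2; -Z 2 p.2 q.2, 0, Z 0 p.2 q.2; Z 1 p.2 q.2, -Z 0 p.2 q.2, 0] p.1 q.1).det := by
  rw [koszulMatrix_det_mix a ha (fun l => B * Z l * Cᵀ), koszulMatrix_det_sandwich B C Z]; ring

/-! ## §1  The Koszul–Strassen form of degree `15` on `ℂ⁷ ⊗ ℂ⁷ ⊗ ℂ⁷` (slices = the three top `A`-letters, rows/columns = the five top `B`- and `C`-letters) -/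

/-- **Evaluation**: at `t`, the form `det K(Y)` in the block variables `x_{(4+k)(2+b)(2+c)}` is `det K` of the block slices of `t`. [bookkeeping] -/
theorem evalT_koszulForm (Y : Fin 3 → Matrix (Fin 5) (Fin 5) (MvPolynomial (Idx 7) ℂ))
    (hY : ∀ k b c, Y k b c = X ((Fin.natAdd 4 k : Fin 7), (Fin.natAdd 2 b : Fin 7), (Fin.natAdd 2 c : Fin 7))) (t : Tensor ℂ 7) :
    evalT t (Matrix.of fun p q : Fin 3 × Fin 5 => !![(0 : MvPolynomial (Idx 7) ℂ), Y 2 p.2 q.2, -Y 1 p.2 q.2; -Y 2 p.2 q.2, 0, Y 0 p.2 q.2; Y 1 p.2 q.2, -Y 0 p.2 q.2, 0] p.1 q.1).det =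
      (Matrix.of fun p q : Fin 3 × Fin 5 => !![(0 : ℂ), (Matrix.of fun b c : Fin 5 => t (Fin.natAdd 4 (2 : Fin 3)) (Fin.natAdd 2 b) (Fin.natAdd 2 c)) p.2 q.2, -(Matrix.of fun b c : Fin 5 => t (Fin.natAdd 4 (1 : Fin 3)) (Fin.natAdd 2 b) (Fin.natAdd 2 c)) p.2 q.2;
        -(Matrix.of fun b c : Fin 5 => t (Fin.natAdd 4 (2 : Fin 3)) (Fin.natAdd 2 b) (Fin.natAdd 2 c)) p.2 q.2, 0, (Matrix.of fun b c : Fin 5 => t (Fin.natAdd 4 (0 : Fin 3)) (Fin.natAdd 2 b) (Fin.natAdd 2 c)) p.2 q.2;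
        (Matrix.of fun b c : Fin 5 => t (Fin.natAdd 4 (1 : Fin 3)) (Fin.natAdd 2 b) (Fin.natAdd 2 c)) p.2 q.2, -(Matrix.of fun b c : Fin 5 => t (Fin.natAdd 4 (0 : Fin 3)) (Fin.natAdd 2 b) (Fin.natAdd 2 c)) p.2 q.2, 0] p.1 q.1).det := by
  rw [AlgHom.map_det]; congr 1; ext ⟨i, b⟩ ⟨j, c⟩
  simp only [AlgHom.mapMatrix_apply, Matrix.map_apply, Matrix.of_apply]
  fin_cases i <;> fin_cases j <;> simp [hY, evalT]

/-- **Block slices of `(A,B,C)·t`** for `A, B, C` vanishing to the left of the blocks: slice `k` of the block of `(A,B,C)·t` is `Σ_{k'} A_{(4+k)(4+k')} · B̄ · Z_{k'}(t) · C̄ᵀ`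
(`B̄, C̄` the bottom-right `5 × 5` corners, `Z_{k'}(t)` the block slices of `t`). [bookkeeping] -/
theorem koszulBlock_actTensor (A B C : Matrix (Fin 7) (Fin 7) ℂ) (t : Tensor ℂ 7) (hA : ∀ (k : Fin 3) (i : Fin 4), A (Fin.natAdd 4 k) (Fin.castAdd 3 i) = 0)
    (hB : ∀ (b : Fin 5) (i : Fin 2), B (Fin.natAdd 2 b) (Fin.castAdd 5 i) = 0) (hC : ∀ (c : Fin 5) (i : Fin 2), C (Fin.natAdd 2 c) (Fin.castAdd 5 i) = 0) (k : Fin 3) :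
    (Matrix.of fun b c : Fin 5 => actTensor A B C t (Fin.natAdd 4 k) (Fin.natAdd 2 b) (Fin.natAdd 2 c)) = ∑ k' : Fin 3, A (Fin.natAdd 4 k) (Fin.natAdd 4 k') •
      ((Matrix.of fun i j : Fin 5 => B (Fin.natAdd 2 i) (Fin.natAdd 2 j)) * (Matrix.of fun b c : Fin 5 => t (Fin.natAdd 4 k') (Fin.natAdd 2 b) (Fin.natAdd 2 c)) *
        (Matrix.of fun i j : Fin 5 => C (Fin.natAdd 2 i) (Fin.natAdd 2 j))ᵀ) := by
  have sA : ∀ f : Fin 7 → ℂ, ∑ x, f x = ∑ i : Fin 4, f (Fin.castAdd 3 i) + ∑ k : Fin 3, f (Fin.natAdd 4 k) := fun f => Fin.sum_univ_add (a := 4) (b := 3) f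
  have sB : ∀ f : Fin 7 → ℂ, ∑ x, f x = ∑ i : Fin 2, f (Fin.castAdd 5 i) + ∑ k : Fin 5, f (Fin.natAdd 2 k) := fun f => Fin.sum_univ_add (a := 2) (b := 5) f
  ext b c
  rw [Matrix.of_apply, actTensor_apply, sA]
  simp only [hA, zero_mul, Finset.sum_const_zero, zero_add]
  simp only [sB, hB, hC, zero_mul, mul_zero, Finset.sum_const_zero, zero_add]
  simp only [Matrix.sum_apply, Matrix.smul_apply, Matrix.mul_apply, Matrix.transpose_apply, Matrix.of_apply, smul_eq_mul, Finset.mul_sum]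
  refine Finset.sum_congr rfl fun k' _ => ?_
  rw [Finset.sum_comm]
  refine Finset.sum_congr rfl fun j _ => ?_
  rw [Finset.sum_mul, Finset.mul_sum]
  refine Finset.sum_congr rfl fun i _ => ?_
  ring

/-- **The Borel law**: the Koszul–Strassen form in the block variables is a weight vector of (reversed) type `((5,5,5),(3,3,3,3,3),(3,3,3,3,3))`, i.e. of exponents
`(0,0,0,0,5,5,5), (0,0,3,3,3,3,3), (0,0,3,3,3,3,3)`, in degree `15`. [cite: LandsbergOttaviani2015, Thm. 2.1] [cite: BurgisserIkenmeyer2011, §3.1] -/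
theorem koszulForm_mem_hwvSpace (Y : Fin 3 → Matrix (Fin 5) (Fin 5) (MvPolynomial (Idx 7) ℂ))
    (hY : ∀ k b c, Y k b c = X ((Fin.natAdd 4 k : Fin 7), (Fin.natAdd 2 b : Fin 7), (Fin.natAdd 2 c : Fin 7))) :
    (Matrix.of fun p q : Fin 3 × Fin 5 => !![(0 : MvPolynomial (Idx 7) ℂ), Y 2 p.2 q.2, -Y 1 p.2 q.2; -Y 2 p.2 q.2, 0, Y 0 p.2 q.2; Y 1 p.2 q.2, -Y 0 p.2 q.2, 0] p.1 q.1).det ∈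
      hwvSpace ![![0, 0, 0, 0, 5, 5, 5], ![0, 0, 3, 3, 3, 3, 3], ![0, 0, 3, 3, 3, 3, 3]] 15 := by
  refine ⟨?_, fun A B C hA hB hC t => ?_⟩
  · have h1 : ∀ p q : Fin 3 × Fin 5, ((Matrix.of fun p q : Fin 3 × Fin 5 => !![(0 : MvPolynomial (Idx 7) ℂ), Y 2 p.2 q.2, -Y 1 p.2 q.2; -Y 2 p.2 q.2, 0, Y 0 p.2 q.2;
        Y 1 p.2 q.2, -Y 0 p.2 q.2, 0] p.1 q.1) p q).IsHomogeneous 1 := by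
      rintro ⟨i, b⟩ ⟨j, c⟩
      fin_cases i <;> fin_cases j <;> simp only [Matrix.of_apply, Matrix.cons_val', Matrix.empty_val', Matrix.cons_val_fin_one, hY] <;>
        first | exact isHomogeneous_zero _ _ _ | exact isHomogeneous_X _ _ | exact (isHomogeneous_X _ _).neg
    simpa using isHomogeneous_det_of_rows _ (fun _ => 1) h1
  have hA0 : ∀ (k : Fin 3) (i : Fin 4), A (Fin.natAdd 4 k) (Fin.castAdd 3 i) = 0 := fun k i => hA.1 _ _ (Fin.lt_def.2 (by simp; omega))
  have hB0 : ∀ (b : Fin 5) (i : Fin 2), B (Fin.natAdd 2 b) (Fin.castAdd 5 i) = 0 := fun b i => hB.1 _ _ (Fin.lt_def.2 (by simp; omega))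
  have hC0 : ∀ (c : Fin 5) (i : Fin 2), C (Fin.natAdd 2 c) (Fin.castAdd 5 i) = 0 := fun c i => hC.1 _ _ (Fin.lt_def.2 (by simp; omega))
  have hdA : Matrix.det (fun k k' : Fin 3 => A (Fin.natAdd 4 k) (Fin.natAdd 4 k') : Matrix (Fin 3) (Fin 3) ℂ) = A 4 4 * A 5 5 * A 6 6 := by
    rw [Matrix.det_of_upperTriangular, Fin.prod_univ_three]
    · rfl
    · exact fun i j hij => hA.1 _ _ ((Fin.natAdd_lt_natAdd_iff 4).2 hij)
  have hd5 : ∀ M : Matrix (Fin 7) (Fin 7) ℂ, M ∈ borel 7 →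
      (Matrix.of fun i j : Fin 5 => M (Fin.natAdd 2 i) (Fin.natAdd 2 j)).det = M 2 2 * M 3 3 * M 4 4 * M 5 5 * M 6 6 := fun M hM => by
    rw [Matrix.det_of_upperTriangular, Fin.prod_univ_five]
    · rfl
    · exact fun i j hij => hM.1 _ _ ((Fin.natAdd_lt_natAdd_iff 2).2 hij)
  have hane : Matrix.det (fun k k' : Fin 3 => A (Fin.natAdd 4 k) (Fin.natAdd 4 k') : Matrix (Fin 3) (Fin 3) ℂ) ≠ 0 := by
    rw [hdA]; exact mul_ne_zero (mul_ne_zero (hA.2 4) (hA.2 5)) (hA.2 6)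
  rw [evalT_koszulForm Y hY, evalT_koszulForm Y hY, koszulBlock_actTensor A B C t hA0 hB0 hC0 0, koszulBlock_actTensor A B C t hA0 hB0 hC0 1,
    koszulBlock_actTensor A B C t hA0 hB0 hC0 2, koszulMatrix_det_act _ hane, hdA, hd5 B hB, hd5 C hC]
  have hw : ∀ (M : Matrix (Fin 7) (Fin 7) ℂ) (u v : ℕ), weightChar ![0, 0, u, u, v, v, v] M = M 2 2 ^ u * M 3 3 ^ u * M 4 4 ^ v * M 5 5 ^ v * M 6 6 ^ v := fun M u v => by
    simp [weightChar, Fin.prod_univ_seven]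
  simp only [Matrix.cons_val_zero, Matrix.cons_val_one, Matrix.cons_val_two, Matrix.head_cons, Matrix.tail_cons, hw, pow_zero, one_mul]
  ring

/-- **The form vanishes on `Mat₇³·⟨7⟩`**: the block `3 × 5 × 5` sub-tensor of `[A|B|C]` has rank `≤ 7` and `2·7 = 14 < 15`, so the Koszul–Strassen matrix is singular
(no invertible slice and no density argument are needed). [cite: LandsbergOttaviani2015, Thm. 2.1] [cite: BurgisserIkenmeyer2011, §3.1] -/
theorem evalT_fromCols_koszulForm (Y : Fin 3 → Matrix (Fin 5) (Fin 5) (MvPolynomial (Idx 7) ℂ))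
    (hY : ∀ k b c, Y k b c = X ((Fin.natAdd 4 k : Fin 7), (Fin.natAdd 2 b : Fin 7), (Fin.natAdd 2 c : Fin 7))) (A B C : Matrix (Fin 7) (Fin 7) ℂ) :
    evalT (fromCols A B C) (Matrix.of fun p q : Fin 3 × Fin 5 => !![(0 : MvPolynomial (Idx 7) ℂ), Y 2 p.2 q.2, -Y 1 p.2 q.2; -Y 2 p.2 q.2, 0, Y 0 p.2 q.2;
      Y 1 p.2 q.2, -Y 0 p.2 q.2, 0] p.1 q.1).det = 0 := by
  rw [evalT_koszulForm Y hY]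
  have hr : tensorRank (fun (k : Fin 3) (b c : Fin 5) => fromCols A B C (Fin.natAdd 4 k) (Fin.natAdd 2 b) (Fin.natAdd 2 c)) ≤ 7 :=
    tensorRank_le_of_eq_sum (fun l k => A (Fin.natAdd 4 k) l) (fun l b => B (Fin.natAdd 2 b) l) (fun l c => C (Fin.natAdd 2 c) l)
      (by funext k b c; simp [fromCols, Finset.sum_apply, triad_apply])
  exact koszulMatrix_det_eq_zero_of_tensorRank_le (by norm_num) _ hr

/-- **Evaluation at a padded integer `5 × 5 × 5` tensor**: the form is `det K` of the (cast) integer slices `a = 2, 3, 4`. [bookkeeping] -/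
theorem evalT_padTensor_koszulForm (Y : Fin 3 → Matrix (Fin 5) (Fin 5) (MvPolynomial (Idx 7) ℂ))
    (hY : ∀ k b c, Y k b c = X ((Fin.natAdd 4 k : Fin 7), (Fin.natAdd 2 b : Fin 7), (Fin.natAdd 2 c : Fin 7))) (z : Fin 5 → Fin 5 → Fin 5 → ℤ) :
    evalT (padTensor (fun i : Fin 5 => (Fin.natAdd 2 i : Fin 7)) fun a b c => (z a b c : ℂ))
        (Matrix.of fun p q : Fin 3 × Fin 5 => !![(0 : MvPolynomial (Idx 7) ℂ), Y 2 p.2 q.2, -Y 1 p.2 q.2; -Y 2 p.2 q.2, 0, Y 0 p.2 q.2; Y 1 p.2 q.2, -Y 0 p.2 q.2, 0] p.1 q.1).det =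
      ((Matrix.of fun p q : Fin 3 × Fin 5 => !![(0 : ℤ), z 4 p.2 q.2, -z 3 p.2 q.2; -z 4 p.2 q.2, 0, z 2 p.2 q.2; z 3 p.2 q.2, -z 2 p.2 q.2, 0] p.1 q.1).map (Int.cast : ℤ → ℂ)).det := by
  rw [evalT_koszulForm Y hY]
  have e0 : (Fin.natAdd 4 (0 : Fin 3) : Fin 7) = Fin.natAdd 2 (2 : Fin 5) := rfl
  have e1 : (Fin.natAdd 4 (1 : Fin 3) : Fin 7) = Fin.natAdd 2 (3 : Fin 5) := rfl
  have e2 : (Fin.natAdd 4 (2 : Fin 3) : Fin 7) = Fin.natAdd 2 (4 : Fin 5) := rfl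
  congr 1; ext ⟨i, b⟩ ⟨j, c⟩
  simp only [Matrix.map_apply, Matrix.of_apply, e0, e1, e2, ObstructionDescentSubformatObstruction.padTensor_apply_emb _ (Fin.natAdd_injective 5 2)]
  fin_cases i <;> fin_cases j <;> simp

set_option maxHeartbeats 100000000 in
set_option maxRecDepth 100000 in
/-- **A `5 × 5 × 5` tensor where the Koszul–Strassen form does not vanish**: `s₀ = (0 | 0 | diag(0,1,2,3,4) | P_cyc | 1)` (slices `a = 0, …, 4`); the
integer matrix `K(diag, P_cyc, 1)` has `det = −4`, certified in the kernel by a sparse integer row certificate (`intTriCheck`: its adjugate rows, `39`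
pairs) giving rank `15` in characteristic zero. [folklore] -/
theorem evalT_padTensor_koszulForm_ne_zero (Y : Fin 3 → Matrix (Fin 5) (Fin 5) (MvPolynomial (Idx 7) ℂ))
    (hY : ∀ k b c, Y k b c = X ((Fin.natAdd 4 k : Fin 7), (Fin.natAdd 2 b : Fin 7), (Fin.natAdd 2 c : Fin 7))) :
    evalT (padTensor (fun i : Fin 5 => (Fin.natAdd 2 i : Fin 7)) fun a b c => ((fun a b c : Fin 5 => if a = 2 ∧ b = c then (b : ℤ) else if (a = 3 ∧ (c : ℕ) = ((b : ℕ) + 1) % 5) ∨ (a = 4 ∧ b = c) then 1 else 0) a b c : ℂ))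
        (Matrix.of fun p q : Fin 3 × Fin 5 => !![(0 : MvPolynomial (Idx 7) ℂ), Y 2 p.2 q.2, -Y 1 p.2 q.2; -Y 2 p.2 q.2, 0, Y 0 p.2 q.2; Y 1 p.2 q.2, -Y 0 p.2 q.2, 0] p.1 q.1).det ≠ 0 := by
  rw [evalT_padTensor_koszulForm Y hY]
  refine det_ne_zero_of_rank_eq_fintype_card _ (le_antisymm (Matrix.rank_le_card_width _) ?_)
  rw [Fintype.card_prod, Fintype.card_fin, Fintype.card_fin]
  exact le_rank_of_intTriCheck (F := ℂ) _ (fun k => ((⟨k / 5 % 3, by omega⟩ : Fin 3), (⟨k % 5, by omega⟩ : Fin 5))) (fun k => ((⟨k / 5 % 3, by omega⟩ : Fin 3), (⟨k % 5, by omega⟩ : Fin 5)))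
    (rows := [[(5, 4)], [(10, -4)], [(1, -8), (7, -4), (11, -8)], [(2, -24), (8, -8), (12, -12)], [(3, -48), (9, -12), (13, -16)], [(0, -4), (6, -4), (10, -4)],
      [(1, -8), (7, -4), (11, -4)], [(2, -12), (8, -4), (12, -4)], [(3, -16), (9, -4), (13, -4)], [(5, 1), (14, 1)], [(4, 4), (5, 1), (14, 1)], [(6, -4), (10, -4)],
      [(1, -4), (7, -4), (11, -4)], [(2, -8), (8, -4), (12, -4)], [(3, -12), (9, -4), (13, -4)]]) (piv := List.range 15) (by decide +kernel)

/-! ## §3  The type `λ_K = ((5,5,5),(3,3,3,3,3),(3,3,3,3,3)) ⊢ 15`: multiplicity one, obstruction against `⟨7⟩`, occurrence on five letters -/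

set_option maxHeartbeats 100000000 in
set_option maxRecDepth 100000 in
/-- The class sum `Σ_C |C| χ^(5, 5, 5)(C) χ^(3, 3, 3, 3, 3)(C)² = 15!` over `S₁₅` (verified Murnaghan–Nakayama evaluator, kernel computation).
[cite: FultonHarrisGTM129, Exercise 4.51] -/
theorem kronSum_koszulType : kronSum 15 [5, 5, 5] [3, 3, 3, 3, 3] [3, 3, 3, 3, 3] = ((15).factorial : ℕ) := by
  decide +kernel

/-- **`g((5,5,5),(3⁵),(3⁵)) = 1`.** [cite: FultonHarrisGTM129, Exercise 4.51] [cite: BurgisserIkenmeyer2011, §10.1] -/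
theorem kroneckerCoeff_koszulType (lam : Fin 3 → Nat.Partition 15) (h0 : (lam 0).sortedParts = [5, 5, 5]) (h1 : (lam 1).sortedParts = [3, 3, 3, 3, 3])
    (h2 : (lam 2).sortedParts = [3, 3, 3, 3, 3]) : kroneckerCoeff ℂ (lam 0) (lam 1) (lam 2) = 1 := by
  have e := kroneckerCoeff_eq_kronSum_div (lam 0) (lam 1) (lam 2)
  rw [h0, h1, h2, kronSum_koszulType, Int.ediv_self (by exact_mod_cast Nat.factorial_ne_zero _)] at e
  exact_mod_cast e

/-- The reversed exponent table of the type `λ_K` in format `7` and the row bound `ℓ(λ^{(k)}) ≤ 7`. [bookkeeping] -/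
theorem koszulType_exponents (lam : Fin 3 → Nat.Partition 15) (h0 : (lam 0).sortedParts = [5, 5, 5]) (h1 : (lam 1).sortedParts = [3, 3, 3, 3, 3])
    (h2 : (lam 2).sortedParts = [3, 3, 3, 3, 3]) :
    (∀ (s : Fin 3) (i : Fin 7), (![![0, 0, 0, 0, 5, 5, 5], ![0, 0, 3, 3, 3, 3, 3], ![0, 0, 3, 3, 3, 3, 3]] : Fin 3 → Fin 7 → ℕ) s (Fin.rev i) = (lam s).sortedParts.getD i 0) ∧
      ∀ s, (lam s).parts.card ≤ 7 := by
  refine ⟨fun s i => ?_, fun s => ?_⟩ <;> obtain rfl | rfl | rfl : s = 0 ∨ s = 1 ∨ s = 2 := by fin_cases s <;> simp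
  · rw [h0]; fin_cases i <;> rfl
  · rw [h1]; fin_cases i <;> rfl
  · rw [h2]; fin_cases i <;> rfl
  · rw [card_parts_eq_length_sortedParts, h0]; decide
  · rw [card_parts_eq_length_sortedParts, h1]; decide
  · rw [card_parts_eq_length_sortedParts, h2]; decide

/-- **The Koszul–Strassen equation is an occurrence obstruction against `⟨7⟩` in degree `15`**: the type `((5,5,5),(3⁵),(3⁵))` does not occur in
`⟨7⟩^{⊗15}` — its highest-weight space in `ℂ[ℂ⁷ ⊗ ℂ⁷ ⊗ ℂ⁷]₁₅` has dimension `≤ g = 1` and contains the form, which is non-zero and vanishes on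
`σ₇ ⊇ GL₇³·⟨7⟩`. [cite: LandsbergOttaviani2015, Thm. 2.1] [cite: BurgisserIkenmeyer2011, §3.1, §10.1] [cite: Strassen1983] -/
theorem isotypicSum_koszulType_unitTensor_seven_eq_zero (lam : Fin 3 → Nat.Partition 15) (h0 : (lam 0).sortedParts = [5, 5, 5])
    (h1 : (lam 1).sortedParts = [3, 3, 3, 3, 3]) (h2 : (lam 2).sortedParts = [3, 3, 3, 3, 3]) :
    isotypicSum₁ (lam 0) (isotypicSum₂ (lam 1) (isotypicSum₃ (lam 2) (kroneckerPow (unitTensor ℂ 7) 15))) = 0 := by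
  classical
  obtain ⟨hΛ', hcard⟩ := koszulType_exponents lam h0 h1 h2
  have hdim : Module.finrank ℂ (hwvSpace ![![0, 0, 0, 0, 5, 5, 5], ![0, 0, 3, 3, 3, 3, 3], ![0, 0, 3, 3, 3, 3, 3]] 15) ≤ 1 := by
    have h := finrank_hwvSpace_le_kroneckerCoeff lam _ hΛ' hcard
    rwa [kroneckerCoeff_koszulType lam h0 h1 h2] at h
  set Y : Fin 3 → Matrix (Fin 5) (Fin 5) (MvPolynomial (Idx 7) ℂ) := fun k => Matrix.of fun b c => X ((Fin.natAdd 4 k : Fin 7), (Fin.natAdd 2 b : Fin 7), (Fin.natAdd 2 c : Fin 7))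
    with hYdef
  have hY : ∀ k b c, Y k b c = X ((Fin.natAdd 4 k : Fin 7), (Fin.natAdd 2 b : Fin 7), (Fin.natAdd 2 c : Fin 7)) := fun _ _ _ => rfl
  have hF0 := evalT_padTensor_koszulForm_ne_zero Y hY
  rw [← hwvSpace_le_orbitVanishing_iff_isotypicSum_eq_zero (unitTensor ℂ 7) lam _ hΛ']
  refine hwvSpace_le_orbitVanishing_of_finrank_le_one hdim (koszulForm_mem_hwvSpace Y hY) (fun h => hF0 (by rw [h, map_zero])) fun A B C _ _ _ => ?_
  rw [actTensor_unitTensor]; exact evalT_fromCols_koszulForm Y hY A B C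

/-- **… and it occurs on five letters**: the type `((5,5,5),(3⁵),(3⁵))` occurs in `s₀^{⊗15}` for the `5 × 5 × 5` tensor `s₀ = (0 | 0 | diag(0,…,4) | P_cyc | 1)`,
since the form does not vanish at (the padding of) `s₀`. [cite: BurgisserIkenmeyer2011, §3.1, Lemma 3.2] -/
theorem isotypicSum_koszulType_witness_ne_zero (lam : Fin 3 → Nat.Partition 15) (h0 : (lam 0).sortedParts = [5, 5, 5])
    (h1 : (lam 1).sortedParts = [3, 3, 3, 3, 3]) (h2 : (lam 2).sortedParts = [3, 3, 3, 3, 3]) :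
    isotypicSum₁ (lam 0) (isotypicSum₂ (lam 1) (isotypicSum₃ (lam 2) (kroneckerPow (fun a b c : Fin 5 => ((fun a b c : Fin 5 => if a = 2 ∧ b = c then (b : ℤ) else if (a = 3 ∧ (c : ℕ) = ((b : ℕ) + 1) % 5) ∨ (a = 4 ∧ b = c) then 1 else 0) a b c : ℂ)) 15))) ≠ 0 := by
  classical
  obtain ⟨hΛ', -⟩ := koszulType_exponents lam h0 h1 h2
  set Y : Fin 3 → Matrix (Fin 5) (Fin 5) (MvPolynomial (Idx 7) ℂ) := fun k => Matrix.of fun b c => X ((Fin.natAdd 4 k : Fin 7), (Fin.natAdd 2 b : Fin 7), (Fin.natAdd 2 c : Fin 7))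
    with hYdef
  have hY : ∀ k b c, Y k b c = X ((Fin.natAdd 4 k : Fin 7), (Fin.natAdd 2 b : Fin 7), (Fin.natAdd 2 c : Fin 7)) := fun _ _ _ => rfl
  rw [← isotypicSum_kroneckerPow_padTensor_ne_zero_iff (Fin.natAdd_injective 5 2) _ lam,
    ← not_hwvSpace_le_orbitVanishing_iff_isotypicSum_ne_zero (padTensor (fun i : Fin 5 => (Fin.natAdd 2 i : Fin 7)) _) lam _ hΛ']
  exact fun hle => not_mem_orbitVanishing_of_evalT_ne_zero (evalT_padTensor_koszulForm_ne_zero Y hY) (hle (koszulForm_mem_hwvSpace Y hY))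

/-- **`¬UOCC(7, 5)`: universal occurrence fails for `⟨7⟩` on five letters** — by the degree-`15` Koszul–Strassen occurrence obstruction of multiplicity
one.  Sharpens the hook-band cell `¬UOCC(6, 5)` (`uocc_five_window`). [cite: LandsbergOttaviani2015, Thm. 2.1] [cite: BurgisserIkenmeyer2011, §3.1, §10.1] -/
theorem not_uocc_seven_five : ¬ (∀ {ι : Type} [Fintype ι], Fintype.card ι ≤ 5 → ∀ (s : ι → ι → ι → ℂ) (d : ℕ) (lam : Fin 3 → Nat.Partition d),
    isotypicSum₁ (lam 0) (isotypicSum₂ (lam 1) (isotypicSum₃ (lam 2) (kroneckerPow s d))) ≠ 0 →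
    isotypicSum₁ (lam 0) (isotypicSum₂ (lam 1) (isotypicSum₃ (lam 2) (kroneckerPow (unitTensor ℂ 7) d))) ≠ 0) := by
  intro h
  have hP : (⟨↑[5, 5, 5], by decide, by decide⟩ : Nat.Partition 15).sortedParts = [5, 5, 5] := by
    change Multiset.sort _ _ = _; rw [Multiset.coe_sort]; exact List.mergeSort_eq_self _ (by decide)
  have hR : (⟨↑[3, 3, 3, 3, 3], by decide, by decide⟩ : Nat.Partition 15).sortedParts = [3, 3, 3, 3, 3] := by
    change Multiset.sort _ _ = _; rw [Multiset.coe_sort]; exact List.mergeSort_eq_self _ (by decide)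
  set lam : Fin 3 → Nat.Partition 15 := ![⟨↑[5, 5, 5], by decide, by decide⟩, ⟨↑[3, 3, 3, 3, 3], by decide, by decide⟩, ⟨↑[3, 3, 3, 3, 3], by decide, by decide⟩]
  exact h (by simp) _ 15 lam (isotypicSum_koszulType_witness_ne_zero lam hP hR hR) (isotypicSum_koszulType_unitTensor_seven_eq_zero lam hP hR hR)

/-- **`u(N) ≥ 8` for every `N ≥ 5`**: `UOCC(m, N) → 8 ≤ m` (the lower cell of row `5`, propagated down the format bound by `uocc_anti_bound` and up the
format by `uocc_mono_format`).  New ladder windows: `8 ≤ u(5) ≤ 10`, `8 ≤ u(6) ≤ 14`. [cite: LandsbergOttaviani2015, Thm. 2.1] [cite: Lickteig1985] -/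
theorem eight_le_of_uocc {m N : ℕ} (hN : 5 ≤ N)
    (hU : ∀ {ι : Type} [Fintype ι], Fintype.card ι ≤ N → ∀ (s : ι → ι → ι → ℂ) (d : ℕ) (lam : Fin 3 → Nat.Partition d),
      isotypicSum₁ (lam 0) (isotypicSum₂ (lam 1) (isotypicSum₃ (lam 2) (kroneckerPow s d))) ≠ 0 →
      isotypicSum₁ (lam 0) (isotypicSum₂ (lam 1) (isotypicSum₃ (lam 2) (kroneckerPow (unitTensor ℂ m) d))) ≠ 0) : 8 ≤ m := by
  by_contra hlt
  exact not_uocc_seven_five (uocc_mono_format (show m ≤ 7 by omega) (uocc_anti_bound hN hU))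

/-- **Row `N = 5` of the universal-occurrence ladder: `8 ≤ u(5) ≤ 10`** — `UOCC(m, 5)` fails for every `m ≤ 7` (Koszul–Strassen, this file) and holds
for every `m ≥ 10` (generic rank `R_gen(5) = 10`, `uocc_five_of_ten_le`).  Previously certified: `[7, 10]`. [cite: LandsbergOttaviani2015, Thm. 2.1] [cite: Lickteig1985] -/
theorem uocc_five_window' {m : ℕ} :
    ((∀ {ι : Type} [Fintype ι], Fintype.card ι ≤ 5 → ∀ (s : ι → ι → ι → ℂ) (d : ℕ) (lam : Fin 3 → Nat.Partition d),
      isotypicSum₁ (lam 0) (isotypicSum₂ (lam 1) (isotypicSum₃ (lam 2) (kroneckerPow s d))) ≠ 0 →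
      isotypicSum₁ (lam 0) (isotypicSum₂ (lam 1) (isotypicSum₃ (lam 2) (kroneckerPow (unitTensor ℂ m) d))) ≠ 0) → 8 ≤ m) ∧
    (10 ≤ m → ∀ {ι : Type} [Fintype ι], Fintype.card ι ≤ 5 → ∀ (s : ι → ι → ι → ℂ) (d : ℕ) (lam : Fin 3 → Nat.Partition d),
      isotypicSum₁ (lam 0) (isotypicSum₂ (lam 1) (isotypicSum₃ (lam 2) (kroneckerPow s d))) ≠ 0 →
      isotypicSum₁ (lam 0) (isotypicSum₂ (lam 1) (isotypicSum₃ (lam 2) (kroneckerPow (unitTensor ℂ m) d))) ≠ 0) :=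
  ⟨eight_le_of_uocc le_rfl, uocc_five_of_ten_le⟩

end Summit.MatrixMultiplication.MatrixMultiplication.Theorems.ObstructionCalculus
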